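import Summits.Ventures.PercRepro.C026SeriesParallel
import Summits.Ventures.PercRepro.C026Recursion
import Summits.Ventures.PercRepro.GladkovThm13

/-!
# The pendant-mark reduction of C-026 at every edge weight (p6, gen 12)

If the mark `c` is pendant on a single edge `f = c–w`, the C-026 slack of `(G, p)` at the marks
`(a, b, c)` is `p_f` times the slack of `(G, p[f := 0])` at the marks `(a, b, w)`:

* split at `f` (`prob_split`): with `f` sure the third mark re-marks to `w`
  (`law3_update_one_eq_of_pendant`), and the pendant edge is then dead for the marks `(a, b, w)`
  (`law3_pendant`); with `f` closed `c` is isolated — the rows `abc`, `ac|b`, `bc|a` vanish and the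
  row `ab|c` is `P(a ~ b)` (`law3_update_zero_*`);
* on the rows: `x = r x'`, `y₁ = r y₁' + (1 − r)(x' + y₁')`, `y₂ = r y₂'`, `y₃ = r y₃'` with `r = p_f`
  and the primed rows those of `(p[f := 0]; a, b, w)`, so `P(a ~ b)` is unchanged and
  `(y₁ + y₂ + y₃) − (x + y₁)(y₁ + z) = r · [(y₁' + y₂' + y₃') − (x' + y₁')(y₁' + z')]`.

**`C026At_of_pendantMark`** is the every-`p` step «a pendant mark moves to its neighbour» of the
reduction calculus (`C026At_of_reduces'`); with the net (`C026Net.lean`) and `c026UpTo5` it settles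
every marked multigraph with at most one cycle (`proofs/P6-unicyclic.md`, Theorem U).  The class-level
counterpart (any pendant star) is p5's `pendant_reduction` (`C026Pendant.lean`).
-/

namespace PercRepro

open Finset

namespace MultiGraph

variable {V E : Type} [Fintype E] [DecidableEq E]

/-- `c` is **pendant on the single edge `f` at `w`**: `c` is pendant at `w` and `f` is its only edge. -/
def PendantOn (G : MultiGraph V E) (c w : V) (f : E) : Prop :=
  G.Pendant c w ∧ ∀ e, e ∈ G.edgesAt ({c} : Set V) → e = f

omit [Fintype E] [DecidableEq E] in
/-- The pendant edge is an edge at `c`. -/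
theorem PendantOn.mem {G : MultiGraph V E} {c w : V} {f : E} (h : G.PendantOn c w f) :
    f ∈ G.edgesAt ({c} : Set V) := by
  obtain ⟨e, he⟩ := h.1.2
  rw [h.2 e he] at he
  exact he

omit [Fintype E] [DecidableEq E] in
/-- With the pendant edge closed, the star at `c` is closed. -/
theorem PendantOn.starClosed {G : MultiGraph V E} {c w : V} {f : E} (h : G.PendantOn c w f)
    {ω : Config E} (hω : ω f = false) : G.StarClosed c ω :=
  fun e he => by rw [h.2 e he]; exact hω

/-- **A sure pendant edge re-marks the third mark**: under `p[f := 1]` the rows of `(a, b, c)` are the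
rows of `(a, b, w)` (on the support `c ~ w`). -/
theorem law3_update_one_eq_of_pendant {G : MultiGraph V E} {c w : V} (hp : G.Pendant c w) {f : E}
    (hf : f ∈ G.edgesAt ({c} : Set V)) (p : E → ℝ) (a b : V) :
    G.law3 (Function.update p f 1) a b c = G.law3 (Function.update p f 1) a b w := by
  funext s
  unfold law3
  rw [← prob_update_one_inter_open,
    ← prob_update_one_inter_open (A := G.partitionEvent ![a, b, w] (rgs3 s))]
  congr 1
  ext ω
  simp only [Set.mem_inter_iff, Set.mem_setOf_eq]
  refine and_congr_left fun hω => ?_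
  have hcw : G.Conn ω c w := G.conn_c_w_of_star_open hp hf hω
  have hpt : ∀ i : Fin 3, G.Conn ω (![a, b, c] i) (![a, b, w] i) := by
    intro i
    fin_cases i
    · exact Conn.refl G ω a
    · exact Conn.refl G ω b
    · exact hcw
  simp only [partitionEvent, Set.mem_setOf_eq]
  refine forall_congr' fun i => forall_congr' fun j => ?_
  exact iff_congr ⟨fun h => (hpt i).symm.trans (h.trans (hpt j)),
    fun h => (hpt i).trans (h.trans (hpt j).symm)⟩ Iff.rfl

/-- With the pendant edge closed the row `abc` vanishes. -/
theorem law3_update_zero_zero {G : MultiGraph V E} {c w : V} {f : E} (h : G.PendantOn c w f)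
    {a : V} (hca : c ≠ a) (p : E → ℝ) (b : V) :
    G.law3 (Function.update p f 0) a b c 0 = 0 := by
  rw [law3_zero, ← prob_update_zero_inter_closed, partitionEvent_row_abc]
  convert prob_empty (Function.update p f 0)
  ext ω
  simp only [Set.mem_inter_iff, mem_connEvent, Set.mem_setOf_eq, Set.mem_empty_iff_false,
    iff_false, not_and]
  rintro ⟨hab, hbc⟩ hω
  exact hca (G.eq_c_of_conn_of_starClosed (h.starClosed hω) (hab.trans hbc).symm).symm

/-- With the pendant edge closed the row `ac|b` vanishes. -/
theorem law3_update_zero_two {G : MultiGraph V E} {c w : V} {f : E} (h : G.PendantOn c w f)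
    {a : V} (hca : c ≠ a) (p : E → ℝ) (b : V) :
    G.law3 (Function.update p f 0) a b c 2 = 0 := by
  rw [law3_two, ← prob_update_zero_inter_closed, partitionEvent_row_ac_b]
  convert prob_empty (Function.update p f 0)
  ext ω
  simp only [Set.mem_inter_iff, mem_connEvent, mem_sepEvent, Set.mem_setOf_eq,
    Set.mem_empty_iff_false, iff_false, not_and]
  rintro ⟨hac, -⟩ hω
  exact hca (G.eq_c_of_conn_of_starClosed (h.starClosed hω) hac.symm).symm

/-- With the pendant edge closed the row `bc|a` vanishes. -/
theorem law3_update_zero_three {G : MultiGraph V E} {c w : V} {f : E} (h : G.PendantOn c w f)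
    {b : V} (hcb : c ≠ b) (p : E → ℝ) (a : V) :
    G.law3 (Function.update p f 0) a b c 3 = 0 := by
  rw [law3_three, ← prob_update_zero_inter_closed, partitionEvent_row_bc_a]
  convert prob_empty (Function.update p f 0)
  ext ω
  simp only [Set.mem_inter_iff, mem_connEvent, mem_sepEvent, Set.mem_setOf_eq,
    Set.mem_empty_iff_false, iff_false, not_and]
  rintro ⟨hbc, -⟩ hω
  exact hcb (G.eq_c_of_conn_of_starClosed (h.starClosed hω) hbc.symm).symm

/-- With the pendant edge closed the row `ab|c` is `P(a ~ b) = x' + y₁'` of the marks `(a, b, w)`. -/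
theorem law3_update_zero_one {G : MultiGraph V E} {c w : V} {f : E} (h : G.PendantOn c w f)
    {a : V} (hca : c ≠ a) (p : E → ℝ) (b : V) :
    G.law3 (Function.update p f 0) a b c 1 =
      G.law3 (Function.update p f 0) a b w 0 + G.law3 (Function.update p f 0) a b w 1 := by
  rw [law3_zero_add_one, law3_one, partitionEvent_row_ab_c, ← prob_update_zero_inter_closed,
    ← prob_update_zero_inter_closed (A := G.connEvent a b)]
  congr 1
  ext ω
  simp only [Set.mem_inter_iff, mem_connEvent, mem_sepEvent, Set.mem_setOf_eq]
  constructor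
  · rintro ⟨⟨hab, -⟩, hω⟩
    exact ⟨hab, hω⟩
  · rintro ⟨hab, hω⟩
    exact ⟨⟨hab, fun hac =>
      hca (G.eq_c_of_conn_of_starClosed (h.starClosed hω) hac.symm).symm⟩, hω⟩

/-- **The pendant-mark reduction at every edge weight**: if `c` is pendant on the single edge
`f = c–w` and C-026 holds for `(G, p[f := 0])` at the marks `(a, b, w)`, it holds for `(G, p)` at
`(a, b, c)` — the slack of `(a, b, c)` is `p_f` times the slack of `(a, b, w)`. -/
theorem C026At_of_pendantMark {G : MultiGraph V E} {p : E → ℝ} (hp : IsProb p) {a b c w : V}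
    {f : E} (h : G.PendantOn c w f) (hcw : c ≠ w) (hca : c ≠ a) (hcb : c ≠ b)
    (hred : G.C026At (Function.update p f 0) a b w) : G.C026At p a b c := by
  have hf := h.mem
  have hsplit : ∀ s, G.law3 p a b c s =
      p f * G.law3 (Function.update p f 1) a b c s +
        (1 - p f) * G.law3 (Function.update p f 0) a b c s := by
    intro s
    unfold law3
    exact prob_split p f _
  have hone : G.law3 (Function.update p f 1) a b c = G.law3 (Function.update p f 0) a b w := by
    rw [G.law3_update_one_eq_of_pendant h.1 hf, law3_pendant h.1 hcw ⟨hca, hcb, hcw⟩ hf,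
      Function.update_idem]
  have h0 := G.law3_update_zero_zero h hca p b
  have h1 := G.law3_update_zero_one h hca p b
  have h2 := G.law3_update_zero_two h hca p b
  have h3 := G.law3_update_zero_three h hcb p a
  have hsum := law3_sum_eq_one G p a b c
  have hsumX := law3_sum_eq_one G (Function.update p f 0) a b w
  have hr0 : 0 ≤ p f := (hp f).1
  unfold C026At at hred ⊢
  have hz : G.law3 p a b c 4 =
      1 - (G.law3 p a b c 0 + G.law3 p a b c 1 + G.law3 p a b c 2 + G.law3 p a b c 3) := by
    linarith
  rw [hz, hsplit 0, hsplit 1, hsplit 2, hsplit 3, hone, h0, h1, h2, h3]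
  set X := G.law3 (Function.update p f 0) a b w with hX
  have hslack : 0 ≤ X 1 + X 2 + X 3 - (X 0 + X 1) * (X 1 + X 4) := by linarith
  have hprod : p f * (X 0 + X 1) * (X 0 + X 1 + X 2 + X 3 + X 4 - 1) = 0 := by
    rw [hsumX]
    ring
  nlinarith [mul_nonneg hr0 hslack, hprod]

end MultiGraph

end PercRepro
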